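import Mathlib.AlgebraicGeometry.AlgClosed.Basic
import Literature.NumberTheory.DiophantineGeometry.AVIsogenyTate
import HarnessLib

/-!
# Geometric points separate morphisms of varieties

Let `K` be a field and `Ω ⊇ K` an algebraically closed field (e.g. `K̄`). **Two `K`-morphisms
`u, v : X → Y` from a reduced `K`-scheme `X` locally of finite type to a `K`-scheme `Y`
separated over `K` which agree on every `Ω`-valued point of `X` over `K` are equal**
(`ext_of_forall_point_eq`; in the tree's language of `SchemeOver K` / `AlgPoints X Ω`:
`SchemeOver.hom_ext_of_forall_algPoints`). In particular a homomorphism of abelian varieties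
over `K` is determined by the map it induces on `K̄`-points (`AbelianVariety.hom_eq_of_geomPointsMap_eq`,
`AbelianVariety.eq_zero_of_geomPointsMap_eq_zero`): the functor `A ↦ A(K̄)` is faithful.

This is the familiar "a morphism of varieties is determined by its values on `K̄`-points"
(Mumford, *Abelian Varieties*, §4, where homomorphisms are manipulated through points; for
schemes: Görtz–Wedhorn I, Prop. 9.2 / EGA IV 17.9: equal on a schematically dense set; here
the closed points of a scheme of finite type over a field are dense — it is Jacobson,
Stacks 01TB — each closed point has residue field finite over `K`, hence a `K`-embedding into
`Ω`, and two morphisms to a separated scheme agreeing after the dominant `Spec Ω → Spec κ(x)`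
agree on `Spec κ(x)`, Mathlib `ext_of_fromSpecResidueField_eq`,
`ext_of_isDominant_of_isSeparated`). Mathlib has the algebraically closed ground field case
(`AlgebraicGeometry.ext_of_apply_eq`, set-theoretic agreement on closed points over `K = K̄`);
the present statement over an arbitrary field `K` with `Ω`-points is what the Galois-module
arguments of the tree (`AbelianVariety.geomPoints = A(K̄)` for `K` a number field) need.

## References

* D. Mumford, *Abelian Varieties*, §4. [MumfordAV1970]
* U. Görtz, T. Wedhorn, *Algebraic Geometry I*, 2nd ed. (2020), Prop. 9.2, and Stacks 01TB.
  [GortzWedhorn2020]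

## Design

Everything is a theorem; no named facts. The scheme-level statement is phrased with explicit
structure morphisms `pX, pY` (Mathlib style), the `Over` and abelian-variety forms are one-line
corollaries. Namespace `Literature.AlgebraicGeometry.Motives` (the directory of `AlgPoints`),
with dot-notation extensions of the tree's `AbelianVariety`.
-/

noncomputable section

open CategoryTheory AlgebraicGeometry

universe u

namespace Literature.AlgebraicGeometry.Motives

section Scheme

variable {K : Type u} [Field K] {X Y : Scheme.{u}} (pX : X ⟶ Spec (.of K))
  (pY : Y ⟶ Spec (.of K)) (Ω : Type u) [Field Ω] [Algebra K Ω] [IsAlgClosed Ω]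

/-- A closed point of a `K`-scheme locally of finite type has residue field finite over `K`
(Stacks 01TB; Mathlib `isFinite_iff_locallyOfFiniteType_of_jacobsonSpace`): the structure map
`K → κ(x)` of `Spec κ(x) → X → Spec K` is finite. [folklore] -/
theorem finite_preimage_fromSpecResidueField [LocallyOfFiniteType pX] {x : X} (hx : IsClosed ({x} : Set X)) :
    (Spec.preimage (X.fromSpecResidueField x ≫ pX)).hom.Finite := by
  have : JacobsonSpace X := LocallyOfFiniteType.jacobsonSpace pX
  have := isClosed_singleton_iff_isClosedImmersion.mp hx
  have hfin : IsFinite (X.fromSpecResidueField x ≫ pX) :=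
    isFinite_iff_locallyOfFiniteType_of_jacobsonSpace.mpr inferInstance
  rw [← Spec.map_preimage (X.fromSpecResidueField x ≫ pX), IsFinite.SpecMap_iff] at hfin
  exact hfin

/-- Through a closed point `x` of a `K`-scheme locally of finite type passes an `Ω`-valued point
over `K`, for every algebraically closed `Ω ⊇ K` (a `K`-embedding `κ(x) → Ω` of the finite
extension `κ(x)/K`). [folklore] -/
theorem exists_point_through_closedPoint [LocallyOfFiniteType pX] {x : X} (hx : IsClosed ({x} : Set X)) :
    ∃ (τ : X.residueField x ⟶ CommRingCat.of Ω),
      (Spec.map τ ≫ X.fromSpecResidueField x) ≫ pX =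
        Spec.map (CommRingCat.ofHom (algebraMap K Ω)) := by
  set φ := Spec.preimage (X.fromSpecResidueField x ≫ pX) with hφdef
  have hφ : Spec.map φ = X.fromSpecResidueField x ≫ pX := Spec.map_preimage _
  letI : Algebra K (X.residueField x) := φ.hom.toAlgebra
  have : Module.Finite K (X.residueField x) := finite_preimage_fromSpecResidueField pX hx
  let τ : X.residueField x →ₐ[K] Ω := IsAlgClosed.lift
  refine ⟨CommRingCat.ofHom τ.toRingHom, ?_⟩
  rw [Category.assoc, ← hφ, ← Spec.map_comp]
  congr 1
  ext a
  exact τ.commutes a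

/-- **`Ω`-points separate morphisms.** Let `X` be a reduced `K`-scheme locally of finite type,
`Y` a `K`-scheme separated over `K`, `Ω ⊇ K` algebraically closed. If two `K`-morphisms
`u, v : X → Y` satisfy `P ≫ u = P ≫ v` for every `Ω`-point `P : Spec Ω → X` over `K`, then
`u = v` (Mumford, *Abelian Varieties* §4; Görtz–Wedhorn I Prop. 9.2 with Stacks 01TB).
[cite: MumfordAV1970, §4] -/
theorem ext_of_forall_point_eq [LocallyOfFiniteType pX] [IsReduced X] [IsSeparated pY]
    {u v : X ⟶ Y} (hu : u ≫ pY = pX) (hv : v ≫ pY = pX)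
    (H : ∀ P : Spec (.of Ω) ⟶ X, P ≫ pX = Spec.map (CommRingCat.ofHom (algebraMap K Ω)) →
      P ≫ u = P ≫ v) :
    u = v := by
  have : JacobsonSpace X := LocallyOfFiniteType.jacobsonSpace pX
  refine ext_of_fromSpecResidueField_eq u v pY (closedPoints X) ?_ ?_ (hu.trans hv.symm)
  · rw [dense_iff_closure_eq, closure_closedPoints]
  · intro x hx
    obtain ⟨τ, hτ⟩ := exists_point_through_closedPoint pX Ω hx
    have hH := H _ hτ
    have : Surjective (Spec.map τ) :=
      ⟨fun y ↦ ⟨IsLocalRing.closedPoint Ω, Subsingleton.elim _ _⟩⟩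
    refine ext_of_isDominant_of_isSeparated pY ?_ (Spec.map τ) ?_
    · rw [Category.assoc, Category.assoc, hu, hv]
    · simpa only [Category.assoc] using hH

end Scheme

/-! ### In the language of `SchemeOver K` and `AlgPoints` -/

section Over

variable {K : Type u} [Field K] {X Y : SchemeOver K} (Ω : Type u) [Field Ω] [Algebra K Ω]
  [IsAlgClosed Ω]

/-- **`Ω`-points separate `K`-morphisms** (`Over` form): for `X` reduced and locally of finite
type and `Y` separated over `K`, two morphisms `u, v : X ⟶ Y` of `K`-schemes with
`P ≫ u = P ≫ v` for all `P ∈ X(Ω) = AlgPoints X Ω` are equal. [cite: MumfordAV1970, §4] -/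
theorem SchemeOver.hom_ext_of_forall_algPoints [LocallyOfFiniteType X.hom] [IsReduced X.left]
    [IsSeparated Y.hom] {u v : X ⟶ Y} (H : ∀ P : AlgPoints X Ω, P ≫ u = P ≫ v) : u = v := by
  ext : 1
  refine ext_of_forall_point_eq X.hom Y.hom Ω (Over.w u) (Over.w v) fun P hP ↦ ?_
  exact congrArg CommaMorphism.left (H (Over.homMk P hP))

end Over

/-! ### Abelian varieties: `A ↦ A(K̄)` is faithful -/

namespace AbelianVariety

variable {K : Type u} [Field K] {A B : AbelianVariety K}

/-- The underlying scheme of an abelian variety is reduced (geometrically integral over a field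
⇒ integral; Mathlib `GeometricallyIntegral.isIntegral_of_subsingleton`). [folklore] -/
theorem isReduced_left (A : AbelianVariety K) : IsReduced A.X.left :=
  have : IsIntegral A.X.left := GeometricallyIntegral.isIntegral_of_subsingleton A.X.hom
  inferInstance

/-- **A homomorphism of abelian varieties is determined by the map it induces on geometric
points**: `geomPointsMap f = geomPointsMap g → f = g` (Mumford, *Abelian Varieties*, §4;
`K̄`-points separate `K`-morphisms from the reduced finite-type `A` to the separated `B`).
[cite: MumfordAV1970, §4] -/
theorem hom_eq_of_geomPointsMap_eq {f g : A ⟶ B}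
    (h : Hom.geomPointsMap f = Hom.geomPointsMap g) : f = g := by
  have : IsReduced A.X.left := isReduced_left A
  have hfg : f.hom.hom.hom = g.hom.hom.hom :=
    SchemeOver.hom_ext_of_forall_algPoints (AlgebraicClosure K) fun P ↦ by
      have hP := congrArg (fun ψ ↦ Additive.toMul (ψ (Additive.ofMul P))) h
      simp only [Hom.geomPointsMap_apply, AlgPoints.map_apply, toMul_ofMul] at hP
      exact hP
  exact hom_ext f g hfg

/-- **A homomorphism of abelian varieties that kills all geometric points is zero**
(faithfulness of `A ↦ A(K̄)`; Mumford, *Abelian Varieties*, §4). [cite: MumfordAV1970, §4] -/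
theorem eq_zero_of_geomPointsMap_eq_zero {f : A ⟶ B} (h : Hom.geomPointsMap f = 0) : f = 0 :=
  hom_eq_of_geomPointsMap_eq (h.trans (Hom.geomPointsMap_zero (A := A) (B := B)).symm)

/-- A non-zero homomorphism of abelian varieties moves some geometric point off zero.
[cite: MumfordAV1970, §4] -/
theorem exists_geomPointsMap_ne_zero {f : A ⟶ B} (hf : f ≠ 0) :
    ∃ P : A.geomPoints, Hom.geomPointsMap f P ≠ 0 := by
  by_contra h
  push Not at h
  exact hf (eq_zero_of_geomPointsMap_eq_zero (AddMonoidHom.ext h))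

end AbelianVariety

end Literature.AlgebraicGeometry.Motives
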